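import Summits.Ventures.PercRepro.ThetaSigmaCredit

/-!
# (Σ): the consistent-point induction closes under strictness

Dossier proofs/MINE1-theoremS.md, Addendum 76 suppl. 4 (mine-1, gen 39). At a sign-consistent
point `e` of a valid (Σ)-instance the credit pays the consistent partner pairs `K = partS e X` as
soon as `|K| ≤ 2` (ThetaSigmaCredit.lean) or (Σ) is strict for `K` (ThetaSigmaProj.lean). The
strict form **(Σ⁺)** — `|X| < |sigmaD U X|` for every valid instance with at least three members
and no extreme member (exhaustively true on every ground set of ≤ 5 points, where the equality
locus is `k ∈ {1, 2, 4}` with an extreme member at `k = 4`; annealing on 6–8 points reaches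
slack `1` at `k = 3, 4, 5` and never `0`) — is exactly what the induction needs from the partner
family, and the partner family of a non-extreme instance is non-extreme:

* `ConjSigmaStrictRel α` — (Σ⁺) relative to every ground set;
* `partS_notMem_empty`, `partS_notMem_self` — the partner family of a non-extreme instance has no
  extreme member;
* `card_le_card_sigmaD_of_consistent` — at a sign-consistent point of a non-extreme instance
  with at least three members, (Σ) for the projection and (Σ⁺) for the partner family (when it
  has at least three members) give (Σ) for the instance;
* `card_le_card_sigmaD_of_consistent_of_strict` — the same with (Σ⁺) as a global hypothesis.

So, under (Σ⁺), a non-extreme instance reduces at EVERY sign-consistent point; what the Credit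
Lemma still has to supply is a point for the instances without one (Addendum 76: in every census
all of their points are good).
-/

namespace PercRepro.MSTight

open Finset

variable {α : Type*} [DecidableEq α] [Fintype α]

/-- **(Σ⁺) relative to every ground set**: a valid instance with at least three members and no
extreme member satisfies (Σ) strictly. -/
def ConjSigmaStrictRel (α : Type*) [DecidableEq α] [Fintype α] : Prop :=
  ∀ (U : Finset α) (X : Finset (Finset α)), SigmaValidRel U X → 3 ≤ X.card → ∅ ∉ X → U ∉ X →
    X.card < (sigmaD U X).card

section Consistent

variable {U : Finset α} {e : α} {X : Finset (Finset α)}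

omit [Fintype α] in
/-- The partner family has no empty member when the instance has none. -/
theorem partS_notMem_empty (h0 : ∅ ∉ X) : ∅ ∉ partS e X := fun h => h0 (mem_partS.1 h).1

omit [Fintype α] in
/-- The partner family has no member `U ∖ e` when the instance does not contain `U`. -/
theorem partS_notMem_self (hU : e ∈ U) (hX : U ∉ X) : U.erase e ∉ partS e X := fun h => by
  obtain ⟨-, -, h'⟩ := mem_partS.1 h
  rw [insert_erase hU] at h'
  exact hX h'

omit [Fintype α] in
/-- **The consistent-point step under strictness for the partners**: at a sign-consistent point of
a non-extreme instance with at least three members, (Σ) for the projection and (Σ⁺) for the partner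
family (when it has at least three members) give (Σ) for the instance. -/
theorem card_le_card_sigmaD_of_consistent (hU : e ∈ U) (hv : SigmaValidRel U X)
    (h3 : 3 ≤ X.card)
    (hP : (projS e X).card ≤ (sigmaD (U.erase e) (projS e X)).card)
    (hK : 3 ≤ (partS e X).card → (partS e X).card < (sigmaD (U.erase e) (partS e X)).card) :
    X.card ≤ (sigmaD U X).card := by
  refine card_le_card_sigmaD_of_projS hP ?_
  rcases Nat.lt_or_ge (partS e X).card 3 with hlt | hge
  · exact card_partS_le_card_creditS_of_le_two hU hv (by omega) fun _ => h3
  · exact card_partS_le_card_creditS_of hU (hK hge).le (Or.inr (hK hge))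

/-- **Under (Σ⁺), a non-extreme instance reduces at every sign-consistent point**: (Σ) for the
projection gives (Σ) for the instance. -/
theorem card_le_card_sigmaD_of_consistent_of_strict (hs : ConjSigmaStrictRel α) (hU : e ∈ U)
    (hv : SigmaValidRel U X) (h3 : 3 ≤ X.card) (h0 : ∅ ∉ X) (hX : U ∉ X)
    (hP : (projS e X).card ≤ (sigmaD (U.erase e) (projS e X)).card) :
    X.card ≤ (sigmaD U X).card :=
  card_le_card_sigmaD_of_consistent hU hv h3 hP fun hge =>
    hs (U.erase e) (partS e X) (sigmaValidRel_partS hU hv) hge (partS_notMem_empty h0)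
      (partS_notMem_self hU hX)

end Consistent

end PercRepro.MSTight
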